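import Mathlib
import Literature.Analysis.Complex.VitaliConvergence

/-!
# Analysis for `SAWChargeContinuation.VitaliTransport` (stmt-CriticalPhenomena-4925), part I

Route `SAWChargeContinuation` of `CriticalPhenomena/SAWScalingLimit`, support item
`VitaliTransport : WindowAvoidanceLaw → ChargeAnalyticity → SAWAvoidanceLaw` (proved in
`SAWChargeContinuationVitaliTransport.lean`, which imports this file). This file holds the two
pure-complex-analysis inputs of that glue, with no lattice content:

* `tendsto_at_zero_of_tendsto_on_window` — **transport of a limit along `[0,1]`**: if, eventually
  along a countably generated filter in `δ`, `t ↦ R δ t` is the trace on `[0,1]` of a holomorphic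
  function on an open `N ⊇ [0,1]` bounded by `C`, and `R δ t → H t` on a real window `(t₀, 1)`
  for some `H` holomorphic on an open `W ⊇ [0,1]`, then `R δ 0 → H 0`. Proof: for every sequence
  `δ_n`, Vitali's convergence theorem of the tree
  (`Literature.Analysis.Complex.exists_tendstoLocallyUniformlyOn_of_frequently_tendsto`) on the
  connected component `U` of `N ∩ W` containing `[0,1]` gives a holomorphic locally uniform limit
  `f`, which agrees with `H` on the window, hence on `U` (identity theorem), so at `0`; the
  subsequence principle (`Filter.tendsto_of_seq_tendsto`) concludes.
* `exists_continuation_rpow_alpha` — the function `t ↦ d ^ α(t)`,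
  `α(t) = (5 + 2t + √((13+2t)² − 144))/16` (the restriction exponent `(6−κ)/2κ` at central charge
  `−2t`; `α(0) = 5/8`, `alpha_zero`), is for every real `d` the trace on `[0,1]` of a function
  holomorphic on a complex neighbourhood of `[0,1]` (principal square root; three cases on the
  sign of `d` following Mathlib's `Real.rpow`).

## References

* E. C. Titchmarsh, *The Theory of Functions*, 2nd ed., §5.21 (Vitali's convergence theorem).
* G. F. Lawler, O. Schramm, W. Werner, *Conformal restriction: the chordal case*, J. Amer. Math.
  Soc. 16 (2003), Thm. 6.1 and §7.2 (the exponents `5/8`, `α_κ = (6−κ)/2κ`).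
-/

noncomputable section

open Filter Set Metric Topology Complex
open scoped Classical

namespace Summit.CriticalPhenomena.SAWScalingLimit.Theorems

namespace SAWChargeContinuationVitali

/-! ## Generic transport along `[0,1]` by Vitali's theorem -/

/-- **Transport of a limit along `[0,1]` by Vitali's theorem.** Let `N, W ⊆ ℂ` be open sets
containing the real segment `[0,1]`, `H` holomorphic on `W`, and let `R δ t ∈ ℂ` (`δ` along a
countably generated filter `l`, `t ∈ [0,1]`) be, eventually in `δ`, the trace on `[0,1]` of a
holomorphic function on `N` bounded by `C`. If `R δ t → H t` for every `t` in a real window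
`(t₀, 1) ∩ [0,1]`, then `R δ 0 → H 0`. (Vitali–Porter on the component of `N ∩ W` containing
`[0,1]`, identity theorem, subsequence principle.) [folklore] -/
theorem tendsto_at_zero_of_tendsto_on_window {N W : Set ℂ} (hN : IsOpen N)
    (hN01 : ∀ t ∈ Icc (0 : ℝ) 1, (t : ℂ) ∈ N) (hW : IsOpen W)
    (hW01 : ∀ t ∈ Icc (0 : ℝ) 1, (t : ℂ) ∈ W) {H : ℂ → ℂ} (hH : DifferentiableOn ℂ H W)
    {l : Filter ℝ} [l.IsCountablyGenerated] {R : ℝ → ℝ → ℂ} {C : ℝ}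
    (hg : ∀ᶠ δ in l, ∃ g : ℂ → ℂ, DifferentiableOn ℂ g N ∧ (∀ s ∈ N, ‖g s‖ ≤ C) ∧
      ∀ t ∈ Icc (0 : ℝ) 1, g t = R δ t)
    {t₀ : ℝ} (ht₀ : t₀ < 1)
    (hwin : ∀ t ∈ Ioo t₀ 1, t ∈ Icc (0 : ℝ) 1 → Tendsto (fun δ => R δ t) l (𝓝 (H t))) :
    Tendsto (fun δ => R δ 0) l (𝓝 (H 0)) := by
  -- the open connected set `U ⊇ [0,1]` on which everything happens
  set V : Set ℂ := N ∩ W with hV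
  set U : Set ℂ := connectedComponentIn V ((1 : ℝ) : ℂ) with hU
  have hVo : IsOpen V := hN.inter hW
  have hUo : IsOpen U := hVo.connectedComponentIn
  have hUc : IsPreconnected U := isPreconnected_connectedComponentIn
  have hUV : U ⊆ V := connectedComponentIn_subset _ _
  have h1V : ((1 : ℝ) : ℂ) ∈ V := ⟨hN01 1 ⟨zero_le_one, le_rfl⟩, hW01 1 ⟨zero_le_one, le_rfl⟩⟩
  have hIU : ∀ t ∈ Icc (0 : ℝ) 1, (t : ℂ) ∈ U := by
    have hpre : IsPreconnected (((↑) : ℝ → ℂ) '' Icc (0 : ℝ) 1) :=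
      isPreconnected_Icc.image _ continuous_ofReal.continuousOn
    have hsub : ((↑) : ℝ → ℂ) '' Icc (0 : ℝ) 1 ⊆ U :=
      hpre.subset_connectedComponentIn ⟨1, ⟨zero_le_one, le_rfl⟩, rfl⟩
        (by rintro _ ⟨t, ht, rfl⟩; exact ⟨hN01 t ht, hW01 t ht⟩)
    exact fun t ht => hsub ⟨t, ht, rfl⟩
  have h1U : ((1 : ℝ) : ℂ) ∈ U := hIU 1 ⟨zero_le_one, le_rfl⟩
  have h0U : ((0 : ℝ) : ℂ) ∈ U := hIU 0 ⟨le_rfl, zero_le_one⟩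
  -- real points approaching `1` from the left, inside the window
  set t₁ : ℝ := max t₀ 0 with ht₁
  have ht₁1 : t₁ < 1 := max_lt ht₀ one_pos
  have hwin' : ∀ t ∈ Ioo t₁ 1, Tendsto (fun δ => R δ t) l (𝓝 (H t)) := fun t ht =>
    hwin t ⟨(le_max_left _ _).trans_lt ht.1, ht.2⟩ ⟨(le_max_right _ _).trans ht.1.le, ht.2.le⟩
  have hIoo01 : ∀ t ∈ Ioo t₁ 1, t ∈ Icc (0 : ℝ) 1 := fun t ht =>
    ⟨(le_max_right _ _).trans ht.1.le, ht.2.le⟩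
  have htend : Tendsto (fun s : ℝ => (s : ℂ)) (𝓝[<] (1 : ℝ)) (𝓝[≠] ((1 : ℝ) : ℂ)) := by
    have h1 : Tendsto (fun s : ℝ => (s : ℂ)) (𝓝[<] (1 : ℝ)) (𝓝[{((1 : ℝ) : ℂ)}ᶜ] ((1 : ℝ) : ℂ)) :=
      continuous_ofReal.continuousWithinAt.tendsto_nhdsWithin fun s hs =>
        fun h => (ne_of_lt hs) (ofReal_injective h)
    simpa using h1
  have hevI : ∀ᶠ s : ℝ in 𝓝[<] (1 : ℝ), s ∈ Ioo t₁ 1 := Ioo_mem_nhdsLT ht₁1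
  -- sequential reduction
  refine tendsto_of_seq_tendsto fun δs hδs => ?_
  have hgs : ∀ᶠ n in atTop, ∃ g : ℂ → ℂ, DifferentiableOn ℂ g N ∧ (∀ s ∈ N, ‖g s‖ ≤ C) ∧
      ∀ t ∈ Icc (0 : ℝ) 1, g t = R (δs n) t := hδs.eventually hg
  -- the sequence of holomorphic functions (junk `0` before the eventual range)
  set F : ℕ → ℂ → ℂ := fun n =>
    if h : ∃ g : ℂ → ℂ, DifferentiableOn ℂ g N ∧ (∀ s ∈ N, ‖g s‖ ≤ C) ∧
        ∀ t ∈ Icc (0 : ℝ) 1, g t = R (δs n) t then h.choose else 0 with hF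
  have hFd : ∀ n, DifferentiableOn ℂ (F n) N := by
    intro n
    simp only [hF]
    split_ifs with h
    · exact h.choose_spec.1
    · exact differentiableOn_const 0
  have hFb : ∀ n, ∀ s ∈ N, ‖F n s‖ ≤ max C 0 := by
    intro n s hs
    simp only [hF]
    split_ifs with h
    · exact (h.choose_spec.2.1 s hs).trans (le_max_left _ _)
    · simp
  have hFR : ∀ᶠ n in atTop, ∀ t ∈ Icc (0 : ℝ) 1, F n t = R (δs n) t := by
    filter_upwards [hgs] with n hn
    intro t ht
    simp only [hF, dif_pos hn]
    exact hn.choose_spec.2.2 t ht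
  -- pointwise convergence on the window
  have hFt : ∀ t ∈ Ioo t₁ 1, Tendsto (fun n => F n t) atTop (𝓝 (H t)) := by
    intro t ht
    have h1 : Tendsto (fun n => R (δs n) t) atTop (𝓝 (H t)) := (hwin' t ht).comp hδs
    refine h1.congr' ?_
    filter_upwards [hFR] with n hn
    exact (hn t (hIoo01 t ht)).symm
  -- Vitali on `U`
  have hFdU : ∀ n, DifferentiableOn ℂ (F n) U := fun n => (hFd n).mono fun z hz => (hUV hz).1
  have hbU : ∀ a ∈ U, ∃ M : ℝ, ∃ r > 0, ∀ n, ∀ z ∈ ball a r ∩ U, ‖F n z‖ ≤ M :=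
    fun a _ => ⟨max C 0, 1, one_pos, fun n z hz => hFb n z (hUV hz.2).1⟩
  have hS : ∃ᶠ z in 𝓝[≠] ((1 : ℝ) : ℂ), ∃ c : ℂ, Tendsto (fun n => F n z) atTop (𝓝 c) := by
    have hev : ∀ᶠ s : ℝ in 𝓝[<] (1 : ℝ), ∃ c : ℂ, Tendsto (fun n => F n s) atTop (𝓝 c) := by
      filter_upwards [hevI] with s hs using ⟨H s, hFt s hs⟩
    exact htend.frequently hev.frequently
  obtain ⟨f, hf, hlim⟩ :=
    Literature.Analysis.Complex.exists_tendstoLocallyUniformlyOn_of_frequently_tendsto hUo hUc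
      hFdU hbU h1U hS
  -- `f = H` on `U` by the identity theorem
  have hfa : AnalyticOnNhd ℂ f U := hf.analyticOnNhd hUo
  have hHa : AnalyticOnNhd ℂ H U := (hH.mono fun z hz => (hUV hz).2).analyticOnNhd hUo
  have hfH : EqOn f H U := by
    have hfreq : ∃ᶠ z in 𝓝[≠] ((1 : ℝ) : ℂ), f z = H z := by
      have hev : ∀ᶠ s : ℝ in 𝓝[<] (1 : ℝ), f s = H s := by
        filter_upwards [hevI] with s hs
        exact tendsto_nhds_unique (hlim.tendsto_at (hIU s (hIoo01 s hs))) (hFt s hs)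
      exact htend.frequently hev.frequently
    exact hfa.eqOn_of_preconnected_of_frequently_eq hHa hUc h1U hfreq
  -- conclusion at `0`
  have h0 : Tendsto (fun n => F n ((0 : ℝ) : ℂ)) atTop (𝓝 (H ((0 : ℝ) : ℂ))) := by
    rw [← hfH h0U]
    exact hlim.tendsto_at h0U
  have h0' : Tendsto (fun n => R (δs n) 0) atTop (𝓝 (H ((0 : ℝ) : ℂ))) := by
    refine h0.congr' ?_
    filter_upwards [hFR] with n hn
    exact hn 0 ⟨le_rfl, zero_le_one⟩
  rw [ofReal_zero] at h0'
  exact h0'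

/-! ## The holomorphic continuation of `s ↦ d ^ α(s)` near `[0,1]` -/

/-- The exponent `α(t) = (5 + 2t + √((13+2t)² − 144))/16` is positive on `[0,1]`. [folklore] -/
theorem alpha_pos {t : ℝ} (ht : t ∈ Icc (0 : ℝ) 1) :
    0 < (5 + 2 * t + Real.sqrt ((13 + 2 * t) ^ 2 - 144)) / 16 := by
  have := Real.sqrt_nonneg ((13 + 2 * t) ^ 2 - 144)
  have := ht.1
  positivity

/-- At `t = 0` the exponent is `α(0) = 5/8` (`√(169 − 144) = 5`). [folklore] -/
theorem alpha_zero : (5 + 2 * (0 : ℝ) + Real.sqrt ((13 + 2 * (0 : ℝ)) ^ 2 - 144)) / 16 = 5 / 8 := by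
  rw [show ((13 : ℝ) + 2 * 0) ^ 2 - 144 = 5 ^ 2 by norm_num, Real.sqrt_sq (by norm_num)]
  norm_num

/-- **Analytic continuation of the restriction exponent law.** For every real `d`, the function
`t ↦ d ^ α(t)` (`Real.rpow`, `α(t) = (5 + 2t + √((13+2t)² − 144))/16`) on `[0,1]` is the trace of
a function `H` holomorphic on an open complex neighbourhood `W` of `[0,1]`: with the principal
square root (the radicand stays in the slit plane near `[0,1]`, where it is `≥ 25`),
`H = exp(log d · α)` for `d > 0`, `H = 0` for `d = 0` (`α > 0`), and
`H = exp(log|d| · α) cos(πα)` for `d < 0` (Mathlib's convention for `Real.rpow` of a negative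
base). [folklore] -/
theorem exists_continuation_rpow_alpha (d : ℝ) :
    ∃ W : Set ℂ, ∃ H : ℂ → ℂ, IsOpen W ∧ (∀ t ∈ Icc (0 : ℝ) 1, (t : ℂ) ∈ W) ∧
      DifferentiableOn ℂ H W ∧
      ∀ t ∈ Icc (0 : ℝ) 1,
        H t = ((d ^ ((5 + 2 * t + Real.sqrt ((13 + 2 * t) ^ 2 - 144)) / 16) : ℝ) : ℂ) := by
  -- the complex exponent and its domain of holomorphy
  set αc : ℂ → ℂ := fun s => (5 + 2 * s + ((13 + 2 * s) ^ 2 - 144) ^ (1 / 2 : ℂ)) / 16 with hαc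
  set W : Set ℂ := {s | (13 + 2 * s) ^ 2 - 144 ∈ slitPlane} with hW
  have hWo : IsOpen W := isOpen_slitPlane.preimage (by fun_prop)
  have hq : ∀ t ∈ Icc (0 : ℝ) 1, (0 : ℝ) < (13 + 2 * t) ^ 2 - 144 := by
    intro t ht; nlinarith [ht.1, ht.2]
  have hcast : ∀ t : ℝ, ((13 + 2 * (t : ℂ)) ^ 2 - 144 : ℂ) = (((13 + 2 * t) ^ 2 - 144 : ℝ) : ℂ) := by
    intro t; push_cast; ring
  have hW01 : ∀ t ∈ Icc (0 : ℝ) 1, (t : ℂ) ∈ W := by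
    intro t ht
    show (13 + 2 * (t : ℂ)) ^ 2 - 144 ∈ slitPlane
    rw [hcast, ofReal_mem_slitPlane]
    exact hq t ht
  have hαd : DifferentiableOn ℂ αc W := by
    intro s hs
    apply DifferentiableAt.differentiableWithinAt
    apply DifferentiableAt.div_const
    apply DifferentiableAt.add (by fun_prop)
    exact DifferentiableAt.cpow_const (by fun_prop) hs
  have hαt : ∀ t ∈ Icc (0 : ℝ) 1,
      αc t = (((5 + 2 * t + Real.sqrt ((13 + 2 * t) ^ 2 - 144)) / 16 : ℝ) : ℂ) := by
    intro t ht
    simp only [hαc]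
    rw [hcast, Real.sqrt_eq_rpow, ofReal_div, ofReal_add, ofReal_add, ofReal_mul,
      ofReal_cpow (hq t ht).le]
    push_cast
    ring
  rcases lt_trichotomy 0 d with hd | rfl | hd
  · -- `d > 0`: `H = exp (log d · α)`
    refine ⟨W, fun s => exp (Real.log d * αc s), hWo, hW01, ?_, ?_⟩
    · exact ((differentiableOn_const _).mul hαd).cexp
    · intro t ht
      simp only []
      rw [hαt t ht, Real.rpow_def_of_pos hd]
      push_cast
      ring_nf
  · -- `d = 0`: `H = 0`
    refine ⟨W, fun _ => 0, hWo, hW01, differentiableOn_const _, ?_⟩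
    intro t ht
    rw [Real.zero_rpow (alpha_pos ht).ne']
    simp
  · -- `d < 0`: `H = exp (log d · α) cos (α π)`
    refine ⟨W, fun s => exp (Real.log d * αc s) * Complex.cos (αc s * Real.pi), hWo, hW01, ?_, ?_⟩
    · exact ((differentiableOn_const _).mul hαd).cexp.mul ((hαd.mul (differentiableOn_const _)).ccos)
    · intro t ht
      simp only []
      rw [hαt t ht, Real.rpow_def_of_neg hd]
      push_cast
      ring_nf

end SAWChargeContinuationVitali

end Summit.CriticalPhenomena.SAWScalingLimit.Theorems
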